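import Mathlib
import Literature.AlgebraicGeometry.Resolution.ResolutionOfCurves

/-!
# `PAlteration.PicoverToRadicialBottom`: the reduced pull-back of an INTEGRAL radicial surjective morphism

Route `ResolutionOfSingularities/pAlteration`, crux `PicoverToRadicialBottom`
(stmt-ResolutionOfSingularities-0556). Helper file (`--supports`): the `IsIntegralHom` variants of
the reduced-pull-back lemmas of `PAlterationAssemblyReduction` (which assume `IsFinite h`; not
imported here). Over a
field `k` with `[k : k^p] = ∞` the Frobenius power `F = powEndo X (p^N)` is integral, universally
injective and surjective but NOT finite, and the pull-back `(X ×_{F,X} Z)_red → Z` of a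
resolution `Z → X'' → X` is accordingly integral + UI + surjective (crux workfile
`Cruxes/PicoverToRadicialBottom/NOTES.md`, §5 stub E and restatement R1): these are the lemmas
that statement needs.

* `isHomeomorph_of_isIntegralHom_of_universallyInjective_of_surjective` — an integral (hence
  universally closed), universally injective, surjective morphism is a homeomorphism;
* `irreducibleSpace_pullback_of_isIntegralHom`, `isIntegral_reduced_pullback_of_isIntegralHom` —
  for such `h : X → T` and `ρ : Y → T` with `Y` irreducible (integral), `X ×_T Y` is irreducible
  and `(X ×_T Y)_red` is integral;
* `isIntegralHom_reduced_pullback_snd` — `(X ×_T Y)_red → Y` is an integral morphism.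
-/

noncomputable section

-- single-problem summit: the doubled namespace component `ResolutionOfSingularities` is forced
set_option linter.dupNamespace false

open CategoryTheory CategoryTheory.Limits AlgebraicGeometry TopologicalSpace Topology

namespace Summit.ResolutionOfSingularities.ResolutionOfSingularities.Theorems

universe u

open Scheme.IdealSheafData

variable {X Y T : Scheme.{u}} (h : X ⟶ T) (ρ : Y ⟶ T)

/-- An integral (hence universally closed), universally injective, surjective morphism is a
homeomorphism (a "universal homeomorphism", Stacks 04DF). [folklore] -/
theorem isHomeomorph_of_isIntegralHom_of_universallyInjective_of_surjective {X T : Scheme.{u}}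
    (h : X ⟶ T) [IsIntegralHom h] [UniversallyInjective h] [Surjective h] :
    IsHomeomorph h.base :=
  isHomeomorph_iff_continuous_isClosedMap_bijective.mpr
    ⟨h.continuous, h.isClosedMap, h.injective, h.surjective⟩

/-- For `h : X → T` integral, universally injective and surjective and `ρ : Y → T` with `Y`
irreducible, the fibre product `X ×_T Y` is irreducible (it is homeomorphic to `Y`). [folklore] -/
theorem irreducibleSpace_pullback_of_isIntegralHom [IsIntegralHom h] [UniversallyInjective h]
    [Surjective h] [IrreducibleSpace Y] : IrreducibleSpace ↑(pullback h ρ) :=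
  haveI : UniversallyInjective (pullback.snd h ρ) :=
    MorphismProperty.pullback_snd (P := @UniversallyInjective) _ _ ‹_›
  (isHomeomorph_of_isIntegralHom_of_universallyInjective_of_surjective
    (pullback.snd h ρ)).homeomorph.irreducibleSpace_iff.mpr ‹_›

/-- For `h : X → T` integral, universally injective and surjective and `ρ : Y → T` with `Y`
integral, the reduced fibre product `(X ×_T Y)_red` is integral. [folklore] -/
theorem isIntegral_reduced_pullback_of_isIntegralHom [IsIntegralHom h] [UniversallyInjective h]
    [Surjective h] [IsIntegral Y] :
    IsIntegral (vanishingIdeal (⊤ : Closeds ↑(pullback h ρ))).subscheme :=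
  haveI := irreducibleSpace_pullback_of_isIntegralHom h ρ
  Literature.AlgebraicGeometry.Resolution.isIntegral_subscheme_vanishingIdeal ⊤
    (by simpa using IrreducibleSpace.isIrreducible_univ ↑(pullback h ρ))

/-- The reduced fibre product `(X ×_T Y)_red → Y` of an integral morphism `h : X → T` is an
integral morphism. [folklore] -/
theorem isIntegralHom_reduced_pullback_snd [IsIntegralHom h] :
    IsIntegralHom ((vanishingIdeal (⊤ : Closeds ↑(pullback h ρ))).subschemeι ≫ pullback.snd h ρ) :=
  inferInstance

end Summit.ResolutionOfSingularities.ResolutionOfSingularities.Theorems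

end
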